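import Summits.BirchSwinnertonDyer.Rank1Residual.JET.E0ReceptacleOfEmbedding
import Literature.NumberTheory.EllipticCurves.InertiaReductionAutomorphismProofs
import HarnessLib

/-!
# Crux `AdditiveBranchIMC.GordTwoRankZeroOffCaseOne` (stmt-BirchSwinnertonDyer-19357), line `genus-stringent-road-k`,
# stub S3 `stub_perPlaceE0GZ` — kernel plumbing: the receptacle `E⁰(K̄_v) = X11b.E0Receptacle (E′⁄K) v` of an
# ARBITRARY model `E′/ℚ` read on a PRESENTED minimal model (`V • E′_{K_v}` minimal; `C • E′` integral and minimal
# at `v`), and the transport `E₀(L)_w (all w ∋ N) → E⁰(K̄_v)` for such a model (helper, `--supports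
# stmt-BirchSwinnertonDyer-19357`; LEAD `cruxlead-stmt-BirchSwinnertonDyer-19357` g22, stub worker S3)

HONEST FRAMING. THEOREMS ONLY (no definition, no named fact, no `sorry`); nothing about BSD is proved; the crux item
stays OPEN; this file is folklore plumbing (Silverman *AEC* VII.1.3 (b), VII.§2) for the stub `stub_perPlaceE0GZ` of
the line `genus-stringent-road-k`, whose statement `GenusStringentRoadK.PerPlaceE0GZ` speaks of the receptacle
`X11b.E0Receptacle (E′.baseChange K) v` of an ARBITRARY Weierstrass model `E′/ℚ` (`[E′.IsElliptic]` only), while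
cell bsd-jet's transport `JET.pointsMap_map_mem_E0Receptacle_of_forall_place` /
`JET.mem_E0Receptacle_some_iff_hasNonsingularReduction_placeIntModel` /
`JET.mem_E0Receptacle_some_iff_reducesToNonsingular` read `E⁰` on the model ITSELF and therefore ask the model to have
integer coefficients and to be minimal at `v`. Here the three lemmas are re-proved for a model PRESENTED as minimal
after a change of variables:

* `mem_E0Receptacle_some_iff_reducesToNonsingular_smul` — for `W/K`, a finite place `v` and a change of variables
  `V` over `K_v` with `V • W_{K_v}` a minimal `𝓞_v`-equation: `(x, y) ∈ E0Receptacle W v` iff the transported point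
  `(V.toX x, V.toY x y)` of `(V • W_{K_v}) ⊗ K̄_v` reduces to a nonsingular point for the spectral valuation `|·|_v`
  (the receptacle's chosen local minimal model `M` and `V • W_{K_v}` are two minimal equations, so they differ by an
  `𝓞_v`-integral change of variables, Silverman VII.1.3 (b) = tree `exists_variableChange_integralModel_eq`, which
  preserves `E₀`, tree `hasNonsingularReduction_variableChange_some_iff`);
* `mem_E0Receptacle_some_iff_hasNonsingularReduction_placeIntModel_smul` — for `E′/ℚ`, `C : VariableChange ℚ` with
  `C • E′` integral and `((C • E′) ⊗ K) ⊗ K_v` minimal, a number field `L` with `e : L → K̄_v` cutting out the place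
  `w`: `(e x, e y) ∈ E0Receptacle (E′ ⊗ K) v` iff `C • (x, y) ∈ E₀(L)_w` on `placeIntModel (C • E′) L w`;
* `pointsMap_map_mem_E0Receptacle_of_forall_place_smul` — the transport: if `C • P` has nonsingular reduction on
  `C • E′` at every place `w ∋ N` of `L`, then for every `ℚ`-embedding `f : L → K̄` the image of `P ∈ E′(L)` in
  `E′(K̄_v)` lies in `E0Receptacle (E′ ⊗ K) v` (`N ∈ v`).

References (locators only; no new fact): [cite: SilvermanAEC2009, VII.1 Prop. 1.3 (b) (PDF p. 165), VII.§2 Prop. 2.1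
(PDF pp. 166–167)] [cite: NeukirchANT1999, Ch. II (8.1)]. presearch: `lean search 'E0Receptacle.*smul|pointEquivBaseChange.*E0Receptacle'`
→ only JET's three lemmas on the model itself (`JET/E0ReceptacleOfEmbedding`, `JET/HeegnerE0ReceptacleByName`) and the
`K_v`-rational form `JET.Receptacle.mem_goodReductionSubgroup_of_mem_E0Receptacle`; no presented-model form. Axioms:
`propext`, `Classical.choice`, `Quot.sound`.
-/

set_option autoImplicit false
-- D-0017: single-problem summit, so `Summit.BirchSwinnertonDyer.BirchSwinnertonDyer.…` repeats a namespace BY DESIGN.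
set_option linter.dupNamespace false

noncomputable section

open scoped Classical NNReal

namespace Summit.BirchSwinnertonDyer.BirchSwinnertonDyer.Theorems.GenusStringentRoadK

open NumberField IsDedekindDomain WeierstrassCurve IsDedekindDomain.HeightOneSpectrum
open Literature.NumberTheory.EllipticCurves Literature.NumberTheory.GaloisRepresentations
open Summit.BirchSwinnertonDyer.Rank1Residual Summit.BirchSwinnertonDyer.Rank1Residual.X11b

/-! ## §0 Coordinate plumbing -/

/-- `ReducesToNonsingular` of an affine point depends only on the equation and the coordinates (transport along
propositional equalities of both). [folklore] -/
theorem reducesToNonsingular_some_congr {L : Type*} [Field L] {w : Valuation L ℝ≥0} {k : Type*} [Field k]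
    {r : w.integer →+* k} {V₁ V₂ : WeierstrassCurve L} (hV : V₁ = V₂) {x₁ y₁ x₂ y₂ : L} (hx : x₁ = x₂)
    (hy : y₁ = y₂) (h₁ : V₁.toAffine.Nonsingular x₁ y₁) (h₂ : V₂.toAffine.Nonsingular x₂ y₂) :
    ReducesToNonsingular w r (.some x₁ y₁ h₁) ↔ ReducesToNonsingular w r (.some x₂ y₂ h₂) := by
  subst hV hx hy
  rfl

/-- `map` of changes of variables is multiplicative and commutes with inverses (Mathlib's `VariableChange.mapHom`).
[folklore] -/
theorem variableChange_map_mul_inv {R : Type*} [CommRing R] {A : Type*} [CommRing A] (φ : R →+* A)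
    (C D : VariableChange R) : (C * D⁻¹).map φ = C.map φ * (D.map φ)⁻¹ := by
  change VariableChange.mapHom φ (C * D⁻¹) = VariableChange.mapHom φ C * (VariableChange.mapHom φ D)⁻¹
  rw [map_mul, map_inv]

variable {K : Type} [Field K] [NumberField K]

/-! ## §1 The receptacle read on a presented minimal model over `K_v` -/

/-- **`E⁰(K̄_v)` read on a presented minimal model** (coordinate form, chosen spectral valuation). For `W/K`
elliptic, a finite place `v` and a change of variables `V` over `K_v` such that `V • W_{K_v}` is a minimal
`𝓞_v`-equation: a point `(x, y) ∈ E(K̄_v)` lies in `X11b.E0Receptacle W v` iff its image `(V.toX x, V.toY x y)` on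
`(V • W_{K_v}) ⊗ K̄_v` reduces to a nonsingular point for the spectral valuation `|·|_v`. The receptacle's chosen local
minimal model `M ⊗ K_v = C₀ • W_{K_v}` equals `(C₀ V⁻¹) • (V • W_{K_v})`, two minimal equations, so `C₀ V⁻¹` is the
image of an `𝓞_v`-integral change of variables (Silverman VII.1.3 (b)), which preserves `E₀` (VII.§2).
[cite: SilvermanAEC2009, VII.1 Prop. 1.3 (b) (PDF p. 165), VII.§2 (PDF p. 166)] -/
theorem mem_E0Receptacle_some_iff_reducesToNonsingular_smul_choose (W : WeierstrassCurve K) [W.IsElliptic]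
    (v : HeightOneSpectrum (𝓞 K)) (V : VariableChange (v.adicCompletion K))
    (hmin : (V • W.baseChange (v.adicCompletion K)).IsMinimal (v.adicCompletionIntegers K))
    {x y : AlgebraicClosure (v.adicCompletion K)}
    (h : (W.baseChange (AlgebraicClosure (v.adicCompletion K))).toAffine.Nonsingular x y)
    (h' : ((V • W.baseChange (v.adicCompletion K)).baseChange
      (AlgebraicClosure (v.adicCompletion K))).toAffine.Nonsingular
      ((V.map (algebraMap (v.adicCompletion K) (AlgebraicClosure (v.adicCompletion K)))).toX x)
      ((V.map (algebraMap (v.adicCompletion K) (AlgebraicClosure (v.adicCompletion K)))).toY x y))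
    {Q : localPoints W (v.adicCompletion K)} (hQ : Q = .some x y h) :
    Q ∈ E0Receptacle W v ↔
      ReducesToNonsingular (v.exists_spectralValuation).choose
        (IsLocalRing.residue (v.exists_spectralValuation).choose.integer)
        (.some _ _ h' : ((V • W.baseChange (v.adicCompletion K)).baseChange
          (AlgebraicClosure (v.adicCompletion K))).toAffine.Point) := by
  subst hQ
  haveI := hmin
  haveI := W.isMinimal_map_localMinimalIntegralModel (v := v)
  -- names for the chosen data
  set w := (v.exists_spectralValuation).choose with hwdef
  have hw : ∀ z, (w z : ℝ) = spectralNorm (v.adicCompletion K) (AlgebraicClosure (v.adicCompletion K)) z :=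
    (v.exists_spectralValuation).choose_spec
  set C₀ := (W.exists_variableChange_eq_localMinimalIntegralModel v).choose with hC₀def
  have hC₀ : C₀ • W.baseChange (v.adicCompletion K) = (W.localMinimalIntegralModel v).map
      (algebraMap (v.adicCompletionIntegers K) (v.adicCompletion K)) :=
    (W.exists_variableChange_eq_localMinimalIntegralModel v).choose_spec
  set ι₀ := (exists_ringHom_adicCompletionIntegers_integer (v.exists_spectralValuation).choose_spec).choose
    with hι₀def
  have hι : ∀ a, ((ι₀ a : w.integer) : AlgebraicClosure (v.adicCompletion K)) =
      algebraMap (v.adicCompletion K) (AlgebraicClosure (v.adicCompletion K)) (a : v.adicCompletion K) :=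
    (exists_ringHom_adicCompletionIntegers_integer (v.exists_spectralValuation).choose_spec).choose_spec
  -- abbreviations for the changes of variables over `K̄_v`
  set V' := V.map (algebraMap (v.adicCompletion K) (AlgebraicClosure (v.adicCompletion K))) with hV'def
  -- the receptacle, unfolded, and the transported coordinates
  rw [X11b.mem_E0Receptacle_iff]
  simp only [Affine.Point.congrEquiv_some, VariableChange.pointEquivBaseChange_some]
  -- VII.1.3(b): `M ⊗ K_v = (C₀ V⁻¹) • (V • W_{K_v})`, both minimal, so `C₀ V⁻¹` is `𝓞_v`-integral
  have h1 : (W.localMinimalIntegralModel v).map (algebraMap (v.adicCompletionIntegers K) (v.adicCompletion K)) =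
      (C₀ * V⁻¹) • (V • W.baseChange (v.adicCompletion K)) := by
    rw [mul_smul, inv_smul_smul]
    exact hC₀.symm
  have hΔ : (V • W.baseChange (v.adicCompletion K)).Δ ≠ 0 :=
    (V • W.baseChange (v.adicCompletion K)).isUnit_Δ.ne_zero
  obtain ⟨D', hD', hint⟩ := exists_variableChange_integralModel_eq (v.adicCompletionIntegers K) h1 hΔ
  rw [X11b.integralModel_map_localMinimalIntegralModel_eq] at hint
  set X₀ := integralModel (v.adicCompletionIntegers K) (V • W.baseChange (v.adicCompletion K)) with hX₀def
  -- the two `𝒪_w`-models differ by the integral change of variables `D'`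
  have hV : (D'.map ι₀) • (X₀.map ι₀) = (W.localMinimalIntegralModel v).map ι₀ := by
    rw [hint, map_variableChange]
  have hDC : (D'.map ι₀).map (algebraMap w.integer (AlgebraicClosure (v.adicCompletion K))) =
      C₀.map (algebraMap (v.adicCompletion K) (AlgebraicClosure (v.adicCompletion K))) * V'⁻¹ := by
    rw [VariableChange.map_map, hV'def, ← variableChange_map_mul_inv, ← hD', VariableChange.map_map]
    congr 1
    exact RingHom.ext fun a ↦ hι a
  have hX : (X₀.map ι₀).baseChange (AlgebraicClosure (v.adicCompletion K)) =
      (V • W.baseChange (v.adicCompletion K)).baseChange (AlgebraicClosure (v.adicCompletion K)) := by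
    rw [← X11b.baseChange_map_eq_baseChange_map_choose v X₀,
      show X₀.map (algebraMap (v.adicCompletionIntegers K) (v.adicCompletion K)) =
        X₀.baseChange (v.adicCompletion K) from rfl,
      hX₀def, baseChange_integralModel_eq]
  have h₄ : ((X₀.map ι₀).baseChange (AlgebraicClosure (v.adicCompletion K))).toAffine.Nonsingular
      (V'.toX x) (V'.toY x y) := by
    rw [hX]; exact h'
  have hx' : (C₀.map (algebraMap (v.adicCompletion K) (AlgebraicClosure (v.adicCompletion K)))).toX x =
      ((D'.map ι₀).map (algebraMap w.integer (AlgebraicClosure (v.adicCompletion K)))).toX (V'.toX x) := by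
    rw [hDC, toX_mul, ← toX_mul V'⁻¹ V' x, inv_mul_cancel, toX_one]
  have hy' : (C₀.map (algebraMap (v.adicCompletion K) (AlgebraicClosure (v.adicCompletion K)))).toY x y =
      ((D'.map ι₀).map (algebraMap w.integer (AlgebraicClosure (v.adicCompletion K)))).toY (V'.toX x)
        (V'.toY x y) := by
    rw [hDC, toY_mul, ← toX_mul V'⁻¹ V' x, ← toY_mul V'⁻¹ V' x y, inv_mul_cancel, toX_one, toY_one]
  rw [hasNonsingularReduction_variableChange_some_iff (X₀.map ι₀) (D'.map ι₀) hV hx' hy' h₄,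
    ← reducesToNonsingular_iff_hasNonsingularReduction (X₀.map ι₀),
    ← Literature.NumberTheory.EllipticCurves.reducesToNonsingular_congrEquiv_iff (IsLocalRing.residue _) hX
      (.some _ _ h₄),
    Affine.Point.congrEquiv_some]

/-- The same for ANY valuation `w₀` presenting the spectral norm (all such coincide).
[cite: SilvermanAEC2009, VII.1 Prop. 1.3 (b), VII.§2] -/
theorem mem_E0Receptacle_some_iff_reducesToNonsingular_smul (W : WeierstrassCurve K) [W.IsElliptic]
    (v : HeightOneSpectrum (𝓞 K)) {w₀ : Valuation (AlgebraicClosure (v.adicCompletion K)) ℝ≥0}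
    (hw₀ : ∀ z, (w₀ z : ℝ) =
      spectralNorm (v.adicCompletion K) (AlgebraicClosure (v.adicCompletion K)) z)
    (V : VariableChange (v.adicCompletion K))
    (hmin : (V • W.baseChange (v.adicCompletion K)).IsMinimal (v.adicCompletionIntegers K))
    {x y : AlgebraicClosure (v.adicCompletion K)}
    (h : (W.baseChange (AlgebraicClosure (v.adicCompletion K))).toAffine.Nonsingular x y)
    (h' : ((V • W.baseChange (v.adicCompletion K)).baseChange
      (AlgebraicClosure (v.adicCompletion K))).toAffine.Nonsingular
      ((V.map (algebraMap (v.adicCompletion K) (AlgebraicClosure (v.adicCompletion K)))).toX x)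
      ((V.map (algebraMap (v.adicCompletion K) (AlgebraicClosure (v.adicCompletion K)))).toY x y))
    {Q : localPoints W (v.adicCompletion K)} (hQ : Q = .some x y h) :
    Q ∈ E0Receptacle W v ↔
      ReducesToNonsingular w₀ (IsLocalRing.residue w₀.integer)
        (.some _ _ h' : ((V • W.baseChange (v.adicCompletion K)).baseChange
          (AlgebraicClosure (v.adicCompletion K))).toAffine.Point) := by
  have heq : w₀ = (v.exists_spectralValuation).choose :=
    Valuation.ext fun z ↦ NNReal.coe_injective
      (by rw [hw₀, (v.exists_spectralValuation).choose_spec])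
  subst heq
  exact mem_E0Receptacle_some_iff_reducesToNonsingular_smul_choose W v V hmin h h' hQ

/-! ## §2 `E⁰(K̄_v)`-membership of a point of `E′(L)` read on `C • E′` at the place cut out by the embedding -/

/-- **`E⁰(K̄_v)`-membership of a point of `E′(L)`, read on a presented integral model `C • E′` minimal at `v`.**
Let `E′/ℚ` be elliptic (any model), `C : VariableChange ℚ` with `C • E′` having integer coefficients, `K` a number
field, `v` a finite place with `((C • E′) ⊗ K) ⊗ K_v` a minimal `𝓞_v`-equation, `e : L → K̄_v` a ring homomorphism
from a number field `L`, and `w` the finite place of `L` equivalent to `|e ·|_v`. Then for `(x, y) ∈ E′(L)`: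
`(e x, e y) ∈ X11b.E0Receptacle (E′ ⊗ K) v` iff `C • (x, y)` has nonsingular reduction at `w` on the model `C • E′`
(`placeIntModel (C • E′) L w`). [cite: SilvermanAEC2009, VII.§2 (`E₀`), VII.1 Prop. 1.3 (b)]
[cite: NeukirchANT1999, Ch. II (8.1)] -/
theorem mem_E0Receptacle_some_iff_hasNonsingularReduction_placeIntModel_smul (E' : WeierstrassCurve ℚ)
    [E'.IsElliptic] (C : VariableChange ℚ) [(C • E').IsIntegral ℤ] (v : HeightOneSpectrum (𝓞 K))
    {w₀ : Valuation (AlgebraicClosure (v.adicCompletion K)) ℝ≥0}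
    (hw₀ : ∀ z, (w₀ z : ℝ) =
      spectralNorm (v.adicCompletion K) (AlgebraicClosure (v.adicCompletion K)) z)
    (hmin : (((C • E').baseChange K).baseChange (v.adicCompletion K)).IsMinimal (v.adicCompletionIntegers K))
    {L : Type} [Field L] [NumberField L] [DecidableEq L] (e : L →+* AlgebraicClosure (v.adicCompletion K))
    {w : HeightOneSpectrum (𝓞 L)} (hwe : (w.valuation L).IsEquiv (w₀.comap e)) {x y : L}
    (h : (E'.baseChange L).toAffine.Nonsingular x y)
    (h' : ((E'.baseChange K).baseChange (AlgebraicClosure (v.adicCompletion K))).toAffine.Nonsingular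
      (e x) (e y)) {Q : localPoints (E'.baseChange K) (v.adicCompletion K)} (hQ : Q = .some _ _ h') :
    Q ∈ E0Receptacle (E'.baseChange K) v ↔
      (placeIntModel (C • E') L w).HasNonsingularReduction (K := L)
        (VariableChange.pointEquivBaseChange E' C L (.some x y h)) := by
  -- the change of variables over `K_v` and over `K̄_v`
  set V : VariableChange (v.adicCompletion K) :=
    (C.map (algebraMap ℚ K)).map (algebraMap K (v.adicCompletion K)) with hVdef
  have hV : ((C • E').baseChange K).baseChange (v.adicCompletion K) =
      V • (E'.baseChange K).baseChange (v.adicCompletion K) := by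
    rw [VariableChange.baseChange_smul_eq, VariableChange.baseChange_smul_eq]
  haveI hmin' : (V • (E'.baseChange K).baseChange (v.adicCompletion K)).IsMinimal
      (v.adicCompletionIntegers K) := hV ▸ hmin
  have hVC : V.map (algebraMap (v.adicCompletion K) (AlgebraicClosure (v.adicCompletion K))) =
      C.map (algebraMap ℚ (AlgebraicClosure (v.adicCompletion K))) := by
    rw [hVdef, VariableChange.map_map, VariableChange.map_map]
    exact congrArg C.map (Subsingleton.elim _ _)
  have hCe : (C.map (algebraMap ℚ L)).map e = C.map (algebraMap ℚ (AlgebraicClosure (v.adicCompletion K))) := by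
    rw [VariableChange.map_map]
    exact congrArg C.map (Subsingleton.elim _ _)
  -- the image over `K̄_v` of the transported point is the transported image
  have hex : (V.map (algebraMap (v.adicCompletion K) (AlgebraicClosure (v.adicCompletion K)))).toX (e x) =
      e ((C.map (algebraMap ℚ L)).toX x) := by
    rw [map_toX_ringHom, hCe, hVC]
  have hey : (V.map (algebraMap (v.adicCompletion K) (AlgebraicClosure (v.adicCompletion K)))).toY (e x) (e y) =
      e ((C.map (algebraMap ℚ L)).toY x y) := by
    rw [map_toY_ringHom, hCe, hVC]
  -- nonsingularity of the transported points
  have h₁ : (((E'.baseChange K).baseChange (v.adicCompletion K)).baseChange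
      (AlgebraicClosure (v.adicCompletion K))).toAffine.Nonsingular (e x) (e y) := by
    rw [baseChange_baseChange_adicCompletion]; exact h'
  have hVs := (VariableChange.nonsingular_iff (((E'.baseChange K).baseChange (v.adicCompletion K)).baseChange
    (AlgebraicClosure (v.adicCompletion K)))
    (V.map (algebraMap (v.adicCompletion K) (AlgebraicClosure (v.adicCompletion K)))) (e x) (e y)).mpr h₁
  rw [← VariableChange.baseChange_smul_eq] at hVs
  have hCb := (VariableChange.nonsingular_iff (E'.baseChange L) (C.map (algebraMap ℚ L)) x y).mpr h
  rw [← VariableChange.baseChange_smul_eq] at hCb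
  have hX1 : (V • (E'.baseChange K).baseChange (v.adicCompletion K)).baseChange
      (AlgebraicClosure (v.adicCompletion K)) =
      ((C • E').baseChange K).baseChange (AlgebraicClosure (v.adicCompletion K)) := by
    rw [← hV, baseChange_baseChange_adicCompletion]
  have h₂ : (((C • E').baseChange K).baseChange (AlgebraicClosure (v.adicCompletion K))).toAffine.Nonsingular
      (e ((C.map (algebraMap ℚ L)).toX x)) (e ((C.map (algebraMap ℚ L)).toY x y)) := by
    rw [← hX1, ← hex, ← hey]; exact hVs
  -- §1 on the presented minimal model, then the two currencies along `e`
  rw [mem_E0Receptacle_some_iff_reducesToNonsingular_smul (E'.baseChange K) v hw₀ V hmin' h' hVs hQ,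
    reducesToNonsingular_some_congr hX1 hex hey hVs h₂, VariableChange.pointEquivBaseChange_some]
  exact reducesToNonsingular_some_iff_hasNonsingularReduction_intModel (C • E')
    (heightOneSpectrum_valuation_intCast_le_one L w) (JET.spectralValuation_intCast_le_one v hw₀) e
    (fun z ↦ Valuation.isEquiv_iff_val_le_one.mp hwe) hCb h₂

/-! ## §3 The transport `E₀(L)_w (all w ∋ N) → E0Receptacle (E′ ⊗ K) v` for a presented model -/

/-- **Transport of `E⁰` along an embedding, for a presented integral model minimal at `v`.** For `E′/ℚ` elliptic
(any model), `C : VariableChange ℚ` with `C • E′` having integer coefficients, a finite place `v` of the number field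
`K` at which `((C • E′) ⊗ K) ⊗ K_v` is a minimal equation and with `N ∈ v`, a number field `L` with a `ℚ`-embedding
`f : L → K̄`, and a point `P ∈ E′(L)` such that `C • P` has nonsingular reduction on `C • E′` at every place `w` of
`L` containing `N`: the image of `P` in `E′(K̄_v)` (along `K̄ → K̄_v`) lies in `E0Receptacle (E′ ⊗ K) v`. (The place
`w` of `L` under `L → K̄ → K̄_v` divides `v ∋ N`; §2.) [cite: SilvermanAEC2009, VII.1 Prop. 1.3 (b), VII.2 Prop. 2.1]
[cite: NeukirchANT1999, Ch. II (8.1)] -/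
theorem pointsMap_map_mem_E0Receptacle_of_forall_place_smul (E' : WeierstrassCurve ℚ) [E'.IsElliptic]
    (C : VariableChange ℚ) [(C • E').IsIntegral ℤ] (v : HeightOneSpectrum (𝓞 K))
    (hmin : (((C • E').baseChange K).baseChange (v.adicCompletion K)).IsMinimal (v.adicCompletionIntegers K))
    {N : ℕ} (hNv : ((N : ℕ) : 𝓞 K) ∈ v.asIdeal) {L : Type} [Field L] [NumberField L]
    [DecidableEq L] (f : L →ₐ[ℚ] AlgebraicClosure K) (P : (E'.baseChange L).toAffine.Point)
    (hP : ∀ w : HeightOneSpectrum (𝓞 L), ((N : ℕ) : 𝓞 L) ∈ w.asIdeal →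
      (placeIntModel (C • E') L w).HasNonsingularReduction (K := L)
        (VariableChange.pointEquivBaseChange E' C L P)) :
    pointsMap (E'.baseChange K) (v.adicCompletion K) (Affine.Point.map (W' := E') f P) ∈
      E0Receptacle (E'.baseChange K) v := by
  obtain ⟨w₀, hw₀⟩ := v.exists_spectralValuation
  -- the embedding `L → K̄ → K̄_v` and the place `w` of `L` it cuts out
  set f' : L →ₐ[ℚ] AlgebraicClosure (v.adicCompletion K) :=
    ((closureEmb (K := K) (v.adicCompletion K)).restrictScalars ℚ).comp f with hf'
  obtain ⟨w, hwe, hwN⟩ :=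
    Literature.NumberTheory.EllipticCurves.exists_heightOneSpectrum_isEquiv_comap hw₀
      (f' : L →+* AlgebraicClosure (v.adicCompletion K))
  rcases P with _ | ⟨x, y, hxy⟩
  · have h0 : pointsMap (E'.baseChange K) (v.adicCompletion K)
        (Affine.Point.map (W' := E') f .zero) = 0 := rfl
    rw [h0]
    exact zero_mem _
  · have hxy' : ((E'.baseChange K).baseChange (AlgebraicClosure K)).toAffine.Nonsingular (f x) (f y) :=
      (Affine.baseChange_nonsingular E' f.injective x y).mpr hxy
    have h' : ((E'.baseChange K).baseChange (AlgebraicClosure (v.adicCompletion K))).toAffine.Nonsingular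
        ((f' : L →+* AlgebraicClosure (v.adicCompletion K)) x)
        ((f' : L →+* AlgebraicClosure (v.adicCompletion K)) y) :=
      (Affine.baseChange_nonsingular E' f'.injective x y).mpr hxy
    have hQ : pointsMap (E'.baseChange K) (v.adicCompletion K)
        (Affine.Point.map (W' := E') f (.some x y hxy)) = .some _ _ h' := by
      rw [Affine.Point.map_some]
      change Affine.Point.map (W' := E'.baseChange K) (closureEmb (K := K) (v.adicCompletion K))
        (.some (f x) (f y) hxy') = _
      rw [Affine.Point.map_some]
      rfl
    exact (mem_E0Receptacle_some_iff_hasNonsingularReduction_placeIntModel_smul E' C v hw₀ hmin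
      (f' : L →+* AlgebraicClosure (v.adicCompletion K)) hwe hxy h' hQ).mpr (hP w (hwN N hNv))

end Summit.BirchSwinnertonDyer.BirchSwinnertonDyer.Theorems.GenusStringentRoadK

end
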